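import Summits.BirchSwinnertonDyer.BirchSwinnertonDyer.Theorems.PrintCFramBottomClassIndexLawFiveLeKrizLiBindersTwistedBlock
import HarnessLib

/-!
# Crux `PrintCFram.BottomClassIndexLawFiveLe` (stmt-BirchSwinnertonDyer-20372), line `eisenstein-resource-bdp-line` (registry v10/v11):
# the HEEGNER HYPOTHESIS for the twisted window classes at `p ∈ {11, 19, 43, 67}` over their census Heegner fields — generic lemmas
# («the bad primes of `W ∼ A(p)^{(d)}` lie in `{p} ∪ primes(d)` (`∪ {2}` for an even-type `d`)», so the hypothesis reduces to finitely many
# splitting checks); the per-class instances are in `…KrizLi4HeegnerHypothesis11.lean` / `…19and43and67.lean`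
# (cell `bsd-print-cfram`, width seat `bsd-line-cfram-p1-w5` g0; THEOREMS ONLY, `--supports` 20372; BSD is not proved by any of this)

HONEST FRAMING. Nothing here proves BSD or closes a stub. The Kriz–Li datum of the composition's on-locus branch needs, besides the character
∧ `ε_K` ∧ (4) block (`KrizLiBindersTwisted.exists_krizLiCharacterBlock_<label>`, landed for all 33 twisted classes at `p ≥ 11`),
`SatisfiesHeegnerHypothesis N_W K''` — every prime of the conductor splits in `K''`. w3 g2 proved it at the anchors (`…Anchor11/19/43/67`:
the only bad prime is `p`). For a twisted member `W ∼ W₁ ≅ E^{(e)}` (`E = A(p)` good away from `p`) the bad primes lie in `{p} ∪ {ℓ ∣ e}`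
when `e ≡ 1 (mod 4)` (w3 g2's `hasGoodReductionAt_quadraticTwist_of_emod_four_any`) and in `{2, p} ∪ {ℓ ∣ e}` in general
(`…_of_odd_any`), so the hypothesis follows from finitely many decomposition-law checks `J(d_K | ℓ) = 1` / `d_K ≡ 1 (mod 8)`
(`Quadratic.ncard_primesOver_eq_two_iff_jacobiSym`, `Quadratic.ncard_primesOver_two_eq_two_iff`):

* §1 `hasGoodReductionAtPrime_of_twist_emod_four` / `hasGoodReductionAtPrime_of_twist_odd_prime` — good reduction of `W` at the primes
  `ℓ ≠ p`, `ℓ ∤ e` (and `ℓ ≠ 2` in the second); `satisfiesHeegnerHypothesis_of_twist_emod_four` / `satisfiesHeegnerHypothesis_of_twist` —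
  the Heegner hypothesis from the splitting of the finitely many candidate bad primes.

beyond-print theorem: NO. References: [SilvermanAEC2009] VII.5 Prop. 5.1(a), VIII.8 Cor. 8.3 (twists and reduction); [GrossLMS1991] §1
(Heegner hypothesis); [Cox2013] §1.C (1.18) (decomposition law); [KrizLi2019] Thm. 1.20 (the datum's Heegner field).
-/

set_option autoImplicit false
set_option linter.dupNamespace false

noncomputable section

open scoped Classical

namespace Summit.BirchSwinnertonDyer.BirchSwinnertonDyer.Theorems.PrintCFram.KrizLiBindersTwisted

open scoped NumberTheorySymbols
open WeierstrassCurve IsDedekindDomain NumberField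
  Literature.NumberTheory.EllipticCurves Literature.NumberTheory.EllipticCurves.ModularForms
  Literature.NumberTheory.EllipticCurves.Rank1Residual Literature.NumberTheory.QuadraticFields
  Summit.BirchSwinnertonDyer.Rank1Residual Summit.BirchSwinnertonDyer.Rank1Residual.X12.O11

variable {p : ℕ}

/-! ## §1 Bad primes of a twist and the Heegner hypothesis from finitely many splitting checks -/

/-- **Good reduction of `W ∼ W₁ ≅ E^{(e)}` at `ℓ ≠ p`, `ℓ ∤ e`, for `e ≡ 1 (mod 4)`** (`E` good away from `p`; ANY prime `ℓ`, also `2`).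
[cite: SilvermanAEC2009, VII.5 Prop. 5.1(a) and VIII.8 Cor. 8.3] -/
theorem hasGoodReductionAtPrime_of_twist_emod_four (E : WeierstrassCurve ℚ) [E.IsElliptic]
    (hgood : ∀ (q : ℕ) [Fact q.Prime], q ≠ p → E.HasGoodReductionAtPrime q)
    (W W₁ : WeierstrassCurve ℚ) [W.IsElliptic] [W₁.IsElliptic] (hiso : IsIsogenous W W₁)
    {e : ℤ} (he4 : e % 4 = 1) (hW₁ : ∃ C : VariableChange ℚ, C • W₁ = E.quadraticTwist (e : ℚ))
    (ℓ : ℕ) [hℓ : Fact ℓ.Prime] (hne : ℓ ≠ p) (hℓe : ¬ ((ℓ : ℤ) ∣ e)) : W.HasGoodReductionAtPrime ℓ := by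
  obtain ⟨C, hC⟩ := hW₁
  obtain ⟨v, hv⟩ : ∃ v : HeightOneSpectrum (𝓞 ℚ), (Rat.HeightOneSpectrum.primesEquiv v : ℕ) = ℓ :=
    ⟨Rat.HeightOneSpectrum.primesEquiv.symm ⟨ℓ, hℓ.out⟩, by rw [Equiv.apply_symm_apply]⟩
  subst hv
  have htw : (E.quadraticTwist (e : ℚ)).HasGoodReductionAt v :=
    KrizLiBinders.hasGoodReductionAt_quadraticTwist_of_emod_four_any E v he4 hℓe
      (KrizLiBinders.hasGoodReductionAt_of_forall_prime_ne E hgood v hne)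
  have h1 : (C • W₁).HasGoodReductionAt v := by rw [hC]; exact htw
  have h2 : W₁.HasGoodReductionAt v := (hasGoodReductionAt_smul_iff_holds v W₁ C).mp h1
  exact (hiso.hasGoodReductionAtPrime_iff _).mpr ((hasGoodReductionAtPrime_iff_hasGoodReductionAt_ringOfIntegers v W₁).mpr h2)

/-- **Good reduction of `W ∼ W₁ ≅ E^{(e)}` at an ODD prime `ℓ ≠ p`, `ℓ ∤ e`, for ANY `e`** (`E` good away from `p`).
[cite: SilvermanAEC2009, VII.5 Prop. 5.1(a) and VIII.8 Cor. 8.3] -/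
theorem hasGoodReductionAtPrime_of_twist_odd_prime (E : WeierstrassCurve ℚ) [E.IsElliptic]
    (hgood : ∀ (q : ℕ) [Fact q.Prime], q ≠ p → E.HasGoodReductionAtPrime q)
    (W W₁ : WeierstrassCurve ℚ) [W.IsElliptic] [W₁.IsElliptic] (hiso : IsIsogenous W W₁)
    {e : ℤ} (hW₁ : ∃ C : VariableChange ℚ, C • W₁ = E.quadraticTwist (e : ℚ))
    (ℓ : ℕ) [hℓ : Fact ℓ.Prime] (hℓ2 : ℓ ≠ 2) (hne : ℓ ≠ p) (hℓe : ¬ ((ℓ : ℤ) ∣ e)) : W.HasGoodReductionAtPrime ℓ := by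
  obtain ⟨C, hC⟩ := hW₁
  obtain ⟨v, hv⟩ : ∃ v : HeightOneSpectrum (𝓞 ℚ), (Rat.HeightOneSpectrum.primesEquiv v : ℕ) = ℓ :=
    ⟨Rat.HeightOneSpectrum.primesEquiv.symm ⟨ℓ, hℓ.out⟩, by rw [Equiv.apply_symm_apply]⟩
  subst hv
  have htw : (E.quadraticTwist (e : ℚ)).HasGoodReductionAt v :=
    KrizLiBinders.hasGoodReductionAt_quadraticTwist_of_odd_any E v hℓ2 hℓe
      (KrizLiBinders.hasGoodReductionAt_of_forall_prime_ne E hgood v hne)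
  have h1 : (C • W₁).HasGoodReductionAt v := by rw [hC]; exact htw
  have h2 : W₁.HasGoodReductionAt v := (hasGoodReductionAt_smul_iff_holds v W₁ C).mp h1
  exact (hiso.hasGoodReductionAtPrime_iff _).mpr ((hasGoodReductionAtPrime_iff_hasGoodReductionAt_ringOfIntegers v W₁).mpr h2)

/-- **Heegner hypothesis from finitely many splitting checks, `e ≡ 1 (mod 4)`.** If every prime `ℓ` with `ℓ = p ∨ ℓ ∣ e` splits in `K`,
then every prime of `N_W` splits in `K` (the other primes are good, hence prime to `N_W`, `not_dvd_conductorNorm_of_hasGoodReductionAtPrime`).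
[cite: GrossLMS1991, §1 (p. 235)] [cite: SilvermanAEC2009, VII.5 Prop. 5.1(a)] -/
theorem satisfiesHeegnerHypothesis_of_twist_emod_four (E : WeierstrassCurve ℚ) [E.IsElliptic]
    (hgood : ∀ (q : ℕ) [Fact q.Prime], q ≠ p → E.HasGoodReductionAtPrime q)
    (W W₁ : WeierstrassCurve ℚ) [W.IsElliptic] [W₁.IsElliptic] (hiso : IsIsogenous W W₁)
    {e : ℤ} (he4 : e % 4 = 1) (hW₁ : ∃ C : VariableChange ℚ, C • W₁ = E.quadraticTwist (e : ℚ))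
    (K : Type) [Field K]
    (hsplit : ∀ ℓ : ℕ, ℓ.Prime → (ℓ = p ∨ (ℓ : ℤ) ∣ e) → ((Ideal.span {(ℓ : ℤ)}).primesOver (𝓞 K)).ncard = 2) :
    SatisfiesHeegnerHypothesis (W.conductorNorm ℤ) K := by
  intro ℓ hℓ hℓN
  by_cases h : ℓ = p ∨ (ℓ : ℤ) ∣ e
  · exact hsplit ℓ hℓ h
  · obtain ⟨h1, h2⟩ := not_or.mp h
    haveI := Fact.mk hℓ
    exact absurd hℓN (not_dvd_conductorNorm_of_hasGoodReductionAtPrime W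
      (hasGoodReductionAtPrime_of_twist_emod_four E hgood W W₁ hiso he4 hW₁ ℓ h1 h2))

/-- **Heegner hypothesis from finitely many splitting checks, any `e`.** If every prime `ℓ` with `ℓ = 2 ∨ ℓ = p ∨ ℓ ∣ e` splits in `K`,
then every prime of `N_W` splits in `K`. [cite: GrossLMS1991, §1 (p. 235)] [cite: SilvermanAEC2009, VII.5 Prop. 5.1(a)] -/
theorem satisfiesHeegnerHypothesis_of_twist (E : WeierstrassCurve ℚ) [E.IsElliptic]
    (hgood : ∀ (q : ℕ) [Fact q.Prime], q ≠ p → E.HasGoodReductionAtPrime q)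
    (W W₁ : WeierstrassCurve ℚ) [W.IsElliptic] [W₁.IsElliptic] (hiso : IsIsogenous W W₁)
    {e : ℤ} (hW₁ : ∃ C : VariableChange ℚ, C • W₁ = E.quadraticTwist (e : ℚ))
    (K : Type) [Field K]
    (hsplit : ∀ ℓ : ℕ, ℓ.Prime → (ℓ = 2 ∨ ℓ = p ∨ (ℓ : ℤ) ∣ e) → ((Ideal.span {(ℓ : ℤ)}).primesOver (𝓞 K)).ncard = 2) :
    SatisfiesHeegnerHypothesis (W.conductorNorm ℤ) K := by
  intro ℓ hℓ hℓN
  by_cases h : ℓ = 2 ∨ ℓ = p ∨ (ℓ : ℤ) ∣ e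
  · exact hsplit ℓ hℓ h
  · obtain ⟨h1, h23⟩ := not_or.mp h
    obtain ⟨h2, h3⟩ := not_or.mp h23
    haveI := Fact.mk hℓ
    exact absurd hℓN (not_dvd_conductorNorm_of_hasGoodReductionAtPrime W
      (hasGoodReductionAtPrime_of_twist_odd_prime E hgood W W₁ hiso hW₁ ℓ h1 h2 h3))

end Summit.BirchSwinnertonDyer.BirchSwinnertonDyer.Theorems.PrintCFram.KrizLiBindersTwisted

end
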